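import Summits.QuantumAdvantage.QuantumAdvantage.Theorems.LocusDialDeclarableA

/-! # LocusDialDeclarable — part 2/2 (mechanical split for landing of `LocusDialDeclarable`; content verbatim; scopes re-opened with their variables) -/

set_option linter.dupNamespace false
noncomputable section
open scoped Classical

namespace Summit.QuantumAdvantage.QuantumAdvantage.Theorems.LocusDial
open Finset
open Literature.Computability.MetaComplexity Literature.Computability.MetaComplexity.Smolensky
variable {N A ℓ : ℕ}

section Declarable
open Literature.Computability.QuantumComplexity Literature.Computability.QuantumComplexity.RingHLF
open Summit.QuantumAdvantage.AdviceFreeQNC0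
open Summit.QuantumAdvantage.QuantumAdvantage.Theorems.HolonomyDial (selP selP_mem selP_apply xorP xorP_mem
  xorP_apply_bool tPoly tPoly_mem tPoly_apply)
open Summit.QuantumAdvantage.QuantumAdvantage.Theorems.AnchorDial (dev MAnchorable)

/-- the intended declared position: the least deviation, or `0` if there is none. -/
def IsDecl (P : Fin N → CubeFn (ZMod 3) N) (x : Fin N → Bool) (k : Fin N) : Prop :=
  (∀ i ∈ dev P x, k.val ≤ i.val) ∧ (k ∈ dev P x ∨ (dev P x = ∅ ∧ k.val = 0))

/-- off the Razborov error set the greedy family declares exactly the intended position. -/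
theorem greedyAnc_eq_one_iff (P : Fin N → CubeFn (ZMod 3) N) (c : Fin ℓ → Fin N → ZMod 3) (x : Fin N → Bool)
    (hx : ∀ k : Fin N, ¬ RazErr c (preI N k) (devPoly P) x) (k : Fin N) :
    greedyAnc P c k x = 1 ↔ IsDecl P x k := by
  have hR := razNor_eq_of_not_err c (preI N k) (devPoly P) x (hx k)
  have hDk := devPoly_apply P k x
  have hval : ∀ i, (devPoly P i x = 0 ↔ i ∉ dev P x) := fun i => by
    rw [devPoly_apply]; split_ifs with h <;> simp [h]
  unfold greedyAnc IsDecl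
  by_cases hk : k.val = 0
  · rw [if_pos hk]
    simp only [Pi.sub_apply, Pi.mul_apply, Pi.one_apply, hR, hDk]
    have hpre : (∀ i ∈ preI N k, devPoly P i x = 0) ↔ ∀ i : Fin N, 0 < i.val → i ∉ dev P x := by
      unfold preI; rw [if_pos hk]
      simp only [mem_filter, mem_univ, true_and, hval]
    have key : (1 - (1 - (if k ∈ dev P x then (1 : ZMod 3) else 0)) *
        (1 - if (∀ i ∈ preI N k, devPoly P i x = 0) then (1 : ZMod 3) else 0)) = 1 ↔
        (k ∈ dev P x ∨ ∀ i ∈ preI N k, devPoly P i x = 0) := by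
      by_cases h1 : k ∈ dev P x <;> by_cases h2 : (∀ i ∈ preI N k, devPoly P i x = 0) <;> simp [h1, h2]
    rw [key, hpre]
    constructor
    · intro h
      refine ⟨fun i _ => by rw [hk]; exact Nat.zero_le _, ?_⟩
      rcases h with h | h
      · exact Or.inl h
      · by_cases h0 : k ∈ dev P x
        · exact Or.inl h0
        · right
          refine ⟨?_, hk⟩
          refine Finset.eq_empty_iff_forall_notMem.2 fun i hi => ?_
          by_cases hi0 : i.val = 0
          · exact h0 (by rwa [show k = i from Fin.ext (by omega)])
          · exact h i (by omega) hi
    · rintro ⟨-, h⟩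
      rcases h with h | ⟨h, -⟩
      · exact Or.inl h
      · exact Or.inr fun i _ => by rw [h]; exact Finset.notMem_empty _
  · rw [if_neg hk]
    simp only [Pi.mul_apply, hR, hDk]
    have hpre : (∀ i ∈ preI N k, devPoly P i x = 0) ↔ ∀ i : Fin N, i.val < k.val → i ∉ dev P x := by
      unfold preI; rw [if_neg hk]
      simp only [mem_filter, mem_univ, true_and, hval]
    have key : ((if k ∈ dev P x then (1 : ZMod 3) else 0) *
        if (∀ i ∈ preI N k, devPoly P i x = 0) then (1 : ZMod 3) else 0) = 1 ↔
        (k ∈ dev P x ∧ ∀ i ∈ preI N k, devPoly P i x = 0) := by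
      by_cases h1 : k ∈ dev P x <;> by_cases h2 : (∀ i ∈ preI N k, devPoly P i x = 0) <;> simp [h1, h2]
    rw [key, hpre]
    constructor
    · rintro ⟨h1, h2⟩
      exact ⟨fun i hi => not_lt.1 fun hlt => h2 i hlt hi, Or.inl h1⟩
    · rintro ⟨h1, h2⟩
      rcases h2 with h2 | ⟨-, h2⟩
      · exact ⟨h2, fun i hi hid => absurd (h1 i hid) (by omega)⟩
      · exact absurd h2 hk

/-- exactly one intended position (for `N ≥ 1`). -/
theorem card_isDecl (hN : 1 ≤ N) (P : Fin N → CubeFn (ZMod 3) N) (x : Fin N → Bool) :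
    ∃ k₀ : Fin N, ∀ k : Fin N, IsDecl P x k ↔ k = k₀ := by
  by_cases hD : (dev P x).Nonempty
  · refine ⟨(dev P x).min' hD, fun k => ?_⟩
    unfold IsDecl
    have hne : dev P x ≠ ∅ := nonempty_iff_ne_empty.1 hD
    constructor
    · rintro ⟨h1, h2⟩
      rcases h2 with h2 | ⟨h2, -⟩
      · apply le_antisymm
        · exact Fin.le_def.2 (h1 _ (min'_mem _ hD))
        · exact min'_le _ _ h2
      · exact absurd h2 hne
    · rintro rfl
      exact ⟨fun i hi => Fin.le_def.1 (min'_le _ i hi), Or.inl (min'_mem _ hD)⟩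
  · have hE : dev P x = ∅ := not_nonempty_iff_eq_empty.1 hD
    refine ⟨⟨0, by omega⟩, fun k => ?_⟩
    unfold IsDecl
    rw [hE]
    constructor
    · rintro ⟨-, h⟩
      rcases h with h | ⟨-, h⟩
      · exact absurd h (Finset.notMem_empty _)
      · exact Fin.ext h
    · rintro rfl
      exact ⟨fun i hi => absurd hi (Finset.notMem_empty _), Or.inr ⟨rfl, rfl⟩⟩

/-- arithmetic: `4·4^L ≤ 9^L` for `L ≥ 2`. -/
theorem pow_budget_49 : ∀ k : ℕ, 2 ^ (2 * (k + 2) + 2) ≤ 3 ^ (2 * (k + 2))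
  | 0 => by norm_num
  | k + 1 => by
    have ih := pow_budget_49 k
    rw [show 2 * (k + 1 + 2) + 2 = 2 * (k + 2) + 2 + 2 by ring, show 2 * (k + 1 + 2) = 2 * (k + 2) + 2 by ring,
      pow_add, pow_add (3 : ℕ)]
    have h49 : (2 : ℕ) ^ 2 ≤ 3 ^ 2 := by norm_num
    exact Nat.mul_le_mul ih h49

/-- arithmetic: `2·n·L ≤ 9^L` for `L = log₂ n ≥ 2`. -/
theorem two_mul_log_budget (n : ℕ) (hL : 2 ≤ Nat.log 2 n) : 2 * n * Nat.log 2 n ≤ 3 ^ (2 * Nat.log 2 n) := by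
  have hn : n < 2 ^ (Nat.log 2 n + 1) := Nat.lt_pow_succ_log_self one_lt_two n
  have hL2 : Nat.log 2 n < 2 ^ Nat.log 2 n := Nat.lt_pow_self one_lt_two
  obtain ⟨k, hk⟩ : ∃ k, Nat.log 2 n = k + 2 := ⟨Nat.log 2 n - 2, by omega⟩
  rw [hk] at hn hL2 ⊢
  calc 2 * n * (k + 2) ≤ 2 * 2 ^ (k + 2 + 1) * 2 ^ (k + 2) :=
        Nat.mul_le_mul (Nat.mul_le_mul_left _ hn.le) hL2.le
    _ = 2 ^ (2 * (k + 2) + 2) := by rw [← pow_succ', ← pow_add]; congr 1; ring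
    _ ≤ 3 ^ (2 * (k + 2)) := pow_budget_49 k

/-- arithmetic: the degree budget `(4L+1)·(2 + 2 L^c) ≤ L^{c+2}` for `L ≥ 17`. -/
theorem greedy_degree_budget (L c : ℕ) (hL : 17 ≤ L) :
    (2 + (L ^ c + L ^ c)) + 2 * L * (2 * (2 + (L ^ c + L ^ c))) ≤ L ^ (c + 2) := by
  have h1 : 1 ≤ L ^ c := Nat.one_le_pow _ _ (by omega)
  have hsq : 4 * (4 * L + 1) ≤ L ^ 2 := by nlinarith
  have e : L ^ (c + 2) = L ^ 2 * L ^ c := by ring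
  rw [e]
  nlinarith

/-- **DECLARABILITY at `m = 1`**: every degree-`(log₂ n)^c` strategy that is few-locus at `(1, r)` is `1`-FREE-anchorable
at width `r` in degree `(log₂ n)^{c+2}` — its (possibly unstable) window is declared, a.e. uniquely, by the GREEDY anchor
family read through a Razborov NOR approximant with an input-averaged seed.  No stability is claimed or possible. -/
theorem mFreeAnchorable_one_of_fewLocus (r c : ℕ) : ∃ n₀ : ℕ, ∀ n ≥ n₀, ∀ P : Fin n → CubeFn (ZMod 3) n,
    (∀ i, P i ∈ lowDeg (ZMod 3) n ((Nat.log 2 n) ^ c)) → FewLocus 1 r P → MFreeAnchorable 1 r (c + 2) P := by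
  refine ⟨2 ^ 17, fun n hn P hP hF => ?_⟩
  set L := Nat.log 2 n with hLdef
  have hL : 17 ≤ L := by
    rw [hLdef]; exact Nat.le_log_of_pow_le (by norm_num) hn
  have hn1 : 1 ≤ n := le_trans (by norm_num) hn
  -- the seed
  obtain ⟨c₀, hc₀⟩ := exists_good_razSeed (ℓ := 2 * L) (fun k : Fin n => preI n k) (devPoly P)
  set E := (univ.filter fun x : Fin n → Bool => ∃ a : Fin n, RazErr c₀ (preI n a) (devPoly P) x) with hE
  have hEb : E.card * 3 ^ (2 * L) ≤ n * 2 ^ n := hc₀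
  have h9 : 2 * n * L ≤ 3 ^ (2 * L) := two_mul_log_budget n (by omega)
  have hLE : L * E.card ≤ 2 ^ (n - 1) := by
    have hpow : 2 ^ n = 2 ^ (n - 1) * 2 := by rw [← pow_succ]; congr 1; omega
    have key : L * E.card * (2 * (n * L)) ≤ 2 ^ (n - 1) * (2 * (n * L)) := by
      calc L * E.card * (2 * (n * L)) = L * (E.card * (2 * n * L)) := by ring
        _ ≤ L * (E.card * 3 ^ (2 * L)) := Nat.mul_le_mul_left _ (Nat.mul_le_mul_left _ h9)
        _ ≤ L * (n * 2 ^ n) := Nat.mul_le_mul_left _ hEb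
        _ = 2 ^ (n - 1) * (2 * (n * L)) := by rw [hpow]; ring
    exact Nat.le_of_mul_le_mul_right key (by positivity)
  -- the anchors
  refine ⟨fun _ => greedyAnc P c₀, fun _ k => ?_, fun _ => ?_, ?_⟩
  · exact lowDeg_mono (greedy_degree_budget L c hL) (greedyAnc_mem hP c₀ k)
  · -- UNIQ a.e.: non-unique inputs lie in the error set
    have hsub : (univ.filter fun x : Fin n → Bool =>
        OddZeros x ∧ (univ.filter fun k : Fin n => greedyAnc P c₀ k x = 1).card ≠ 1) ⊆ E := by
      intro x hx
      rw [mem_filter] at hx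
      rw [hE, mem_filter]
      refine ⟨mem_univ _, ?_⟩
      by_contra hne
      push Not at hne
      apply hx.2.2
      obtain ⟨k₀, hk₀⟩ := card_isDecl hn1 P x
      rw [card_eq_one]
      refine ⟨k₀, ?_⟩
      ext k
      rw [mem_filter, mem_singleton]
      simp only [mem_univ, true_and]
      rw [greedyAnc_eq_one_iff P c₀ x hne k, hk₀ k]
    rw [← hLdef]
    exact le_trans (Nat.mul_le_mul_left _ (card_le_card hsub)) hLE
  · -- NEAR a.e.: failures lie in the error set or the non-coverable set
    have hsub : (univ.filter fun x : Fin n → Bool => OddZeros x ∧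
        ¬ ∃ kv : Fin 1 → Fin n, (∀ j, (fun _ => greedyAnc P c₀) j (kv j) x = 1) ∧
          ∀ i ∈ dev P x, ∃ j, (kv j).val ≤ i.val ∧ i.val ≤ (kv j).val + r) ⊆
        E ∪ (univ.filter fun x : Fin n → Bool => OddZeros x ∧ ¬ Coverable 1 r (dev P x)) := by
      intro x hx
      rw [mem_filter] at hx
      rw [mem_union]
      by_contra hno
      push Not at hno
      obtain ⟨hxE, hxC⟩ := hno
      have hne : ∀ k : Fin n, ¬ RazErr c₀ (preI n k) (devPoly P) x := by
        intro k hk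
        exact hxE (by rw [hE, mem_filter]; exact ⟨mem_univ _, k, hk⟩)
      have hcov : Coverable 1 r (dev P x) := by
        by_contra h
        exact hxC (mem_filter.2 ⟨mem_univ _, hx.2.1, h⟩)
      obtain ⟨k₀, hk₀⟩ := card_isDecl hn1 P x
      have hdecl : IsDecl P x k₀ := (hk₀ k₀).2 rfl
      apply hx.2.2
      refine ⟨fun _ => k₀, fun _ => (greedyAnc_eq_one_iff P c₀ x hne k₀).2 hdecl, fun i hi => ⟨0, hdecl.1 i hi, ?_⟩⟩
      show i.val ≤ k₀.val + r
      obtain ⟨kv, hkv⟩ := hcov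
      obtain ⟨j, hj1, hj2⟩ := hkv i hi
      have hj : j = 0 := Subsingleton.elim _ _
      subst hj
      -- k₀ is a deviation (dev nonempty since i ∈ dev), so kv 0 ≤ k₀
      have hk0dev : k₀ ∈ dev P x := by
        rcases hdecl.2 with h | ⟨h, -⟩
        · exact h
        · rw [h] at hi; exact absurd hi (Finset.notMem_empty _)
      obtain ⟨j', hj'1, _⟩ := hkv k₀ hk0dev
      have hj' : j' = 0 := Subsingleton.elim _ _
      subst hj'
      omega
    have hNC : L * (univ.filter fun x : Fin n → Bool => OddZeros x ∧ ¬ Coverable 1 r (dev P x)).card ≤ 2 ^ (n - 1) := hF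
    have hpow : 2 ^ n = 2 ^ (n - 1) + 2 ^ (n - 1) := by rw [← two_mul, ← pow_succ']; congr 1; omega
    rw [← hLdef, hpow]
    calc L * (univ.filter fun x : Fin n → Bool => OddZeros x ∧
          ¬ ∃ kv : Fin 1 → Fin n, (∀ j, (fun _ => greedyAnc P c₀) j (kv j) x = 1) ∧
            ∀ i ∈ dev P x, ∃ j, (kv j).val ≤ i.val ∧ i.val ≤ (kv j).val + r).card
        ≤ L * (E ∪ (univ.filter fun x : Fin n → Bool => OddZeros x ∧ ¬ Coverable 1 r (dev P x))).card :=
          Nat.mul_le_mul_left _ (card_le_card hsub)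
      _ ≤ L * (E.card + (univ.filter fun x : Fin n → Bool => OddZeros x ∧ ¬ Coverable 1 r (dev P x)).card) :=
          Nat.mul_le_mul_left _ (card_union_le _ _)
      _ ≤ 2 ^ (n - 1) + 2 ^ (n - 1) := by rw [mul_add]; exact Nat.add_le_add hLE hNC

/-! ## §R3  The UNSTABLE-ANCHOR law `MFreeAnchorLoss3` and the `m = 1` slice of `U` -/

/-- **`MFreeAnchorLoss3` — `T` RESTRICTED TO FREE-ANCHORABLE STRATEGIES**: for every `m, r, c`, every degree-`(log₂ n)^c`
strategy whose deviation set is a.e. covered by `m` windows of width `r` at a.e.-uniquely DECLARED (degree `(log₂ n)^c`),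
possibly UNSTABLE positions loses a polynomial fraction of the odd class.  NECESSARY (restriction of `T`); by DECLARABILITY
it GIVES the `m = 1` slice of `U` with no anchoring hypothesis at all (`fewLocusLossOne3_of_mFreeAnchorLoss3`); the stable
sub-case is g15's PROVED `MultiAnchorLoss3`.  This is piece `U` in DECLARED form: its open content is exactly the missing
STABILITY. -/
def MFreeAnchorLoss3 : Prop :=
  ∃ C : ℕ, ∀ m r c : ℕ, ∃ n₀ : ℕ, ∀ n ≥ n₀, ∀ P : Fin n → CubeFn (ZMod 3) n,
    (∀ i, P i ∈ lowDeg (ZMod 3) n ((Nat.log 2 n) ^ c)) → MFreeAnchorable m r c P →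
      ((univ.filter fun x : Fin n → Bool => OddZeros x ∧ Rel x (fun i => decide (P i x = 1))).card : ℝ) ≤
        (1 - 1 / (n : ℝ) ^ C) * (2 : ℝ) ^ (n - 1)

/-- `T → MFreeAnchorLoss3` (restriction). -/
theorem mFreeAnchorLoss3_of_polyLossOddU3 (h : Summit.QuantumAdvantage.QuantumAdvantage.Theses.ExactnessDial.PolyLossOddU3) :
    MFreeAnchorLoss3 := by
  obtain ⟨C, hC⟩ := h
  refine ⟨C, fun _ _ c => ?_⟩
  obtain ⟨n₀, hn₀⟩ := hC c
  exact ⟨n₀, fun n hn P hP _ => hn₀ n hn P hP⟩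

/-- **the `m = 1` SLICE of `U`**: `T` restricted to strategies few-locus at ONE window of width `r` (arbitrary, undeclared,
input-dependent location). -/
def FewLocusLossOne3 : Prop :=
  ∃ C : ℕ, ∀ r c : ℕ, ∃ n₀ : ℕ, ∀ n ≥ n₀, ∀ P : Fin n → CubeFn (ZMod 3) n,
    (∀ i, P i ∈ lowDeg (ZMod 3) n ((Nat.log 2 n) ^ c)) → FewLocus 1 r P →
      ((univ.filter fun x : Fin n → Bool => OddZeros x ∧ Rel x (fun i => decide (P i x = 1))).card : ℝ) ≤
        (1 - 1 / (n : ℝ) ^ C) * (2 : ℝ) ^ (n - 1)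

/-- `U →` its `m = 1` slice. -/
theorem fewLocusLossOne3_of_fewLocusLoss3 (h : FewLocusLoss3) : FewLocusLossOne3 := by
  obtain ⟨C, hC⟩ := h
  exact ⟨C, fun r c => hC 1 r c⟩

/-- **DECLARED FORM OF THE `m = 1` SLICE**: the unstable-anchor law gives the one-window slice of `U` outright
(declarability `mFreeAnchorable_one_of_fewLocus` + degree monotonicity). -/
theorem fewLocusLossOne3_of_mFreeAnchorLoss3 (h : MFreeAnchorLoss3) : FewLocusLossOne3 := by
  obtain ⟨C, hC⟩ := h
  refine ⟨C, fun r c => ?_⟩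
  obtain ⟨n₁, hn₁⟩ := hC 1 r (c + 2)
  obtain ⟨n₂, hn₂⟩ := mFreeAnchorable_one_of_fewLocus r c
  refine ⟨max (max n₁ n₂) 4, fun n hn P hP hF => ?_⟩
  have hn1 : n₁ ≤ n := le_trans (le_trans (le_max_left _ _) (le_max_left _ _)) hn
  have hn2 : n₂ ≤ n := le_trans (le_trans (le_max_right _ _) (le_max_left _ _)) hn
  have hn4 : 4 ≤ n := le_trans (le_max_right _ _) hn
  have hlog : 1 ≤ Nat.log 2 n := Nat.le_log_of_pow_le (by norm_num) (by omega)
  have hdeg : ∀ i, P i ∈ lowDeg (ZMod 3) n ((Nat.log 2 n) ^ (c + 2)) := fun i =>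
    lowDeg_mono (Nat.pow_le_pow_right hlog (by omega)) (hP i)
  exact hn₁ n hn1 P hdeg (hn₂ n hn2 P hP hF)

end Declarable

end Summit.QuantumAdvantage.QuantumAdvantage.Theorems.LocusDial
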